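import Summits.FinalStateConjecture.FinalStateConjecture.Theorems.EIHFluxBalanceInertialRecessionStubSlavingCOERCompactBoosts
import Summits.FinalStateConjecture.FinalStateConjecture.Theorems.EIHFluxBalanceInertialRecessionStubSlavingImmersion
import Summits.FinalStateConjecture.FinalStateConjecture.Theorems.EIHFluxBalanceInertialRecessionSlavingSpatialRigidity

/-!
# Route EIHFluxBalance — `InertialRecession` (E′), line `SketchCleanExcision`, skeleton r13,
# stub `stub_coerSymbolQuant` (C): the three lab AXIS EVENTS of a boosted hole on the lab slab

Helper file for the crux `stmt-FinalStateConjecture-17403`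
(`Summit.FinalStateConjecture.FinalStateConjecture.Theses.EIHFluxBalance.InertialRecession`, E′),
registered stub `stub_coerSymbolQuant` (quantitative uniform robust COER-B). Lorentz bookkeeping for
the kernel step `axisKernel_slab` read in the LAB frame of a hole with Lorentz label `Λ`,
`|(Λe₀)⁰| ≤ γ`:

* `coerSym_lorentz_apply_three_zero`, `coerSym_abs_v3_lt_one` — `(Λe₃)⁰ = −(Λ⁻¹e₀)³`, hence the
  forced rest-time slope `v₃ = (Λe₃)⁰/(Λe₀)⁰` has `|v₃| < 1`;
* `coerSym_axis_event` — a rest axis point `P = (−v₃ζ, 0, 0, ζ)` is mapped to the lab slab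
  `{x⁰ = 0}`, with lab distance between `|ζ|/(1 + 3γ)` and `2(1 + 3γ)|ζ|` (`norm_lorentz_le`);
* `coerSym_lorentz_of_mem_lorentzBounded` — an `η`-isometric operator `S` with `|(Se₀)⁰| ≤ γ` is
  `Λ⁻¹` for some `Λ ∈ O(1,3)` with `|(Λe₀)⁰| ≤ γ` (limits of painted frames in the compact set
  `isCompact_lorentzBounded` are painted frames);
* `coerSym_symm_mem_lorentzBounded`, `coerSym_le_radius_symm` — `Λ⁻¹` lies in that compact set, and
  the painted radius on the lab shell `{x⁰ = 0, ‖x⃗‖ ≥ |a| + L}` is `≥ L` for every boost.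

Elementary; no definitions, no named facts, no `sorry`.
-/

set_option linter.dupNamespace false

noncomputable section

open Set Function Metric Literature.Geometry.Lorentzian
  Summit.FinalStateConjecture.FinalStateConjecture.Theorems

namespace Summit.FinalStateConjecture.FinalStateConjecture.Theorems.SublinearIsFree.Slaving

/-! ### The forced rest-time slope `v₃` -/

section Slope

/-- `(Λ e₃)⁰ = −(Λ⁻¹ e₀)³`: `(Λe₃)⁰ = −η(e₀, Λe₃) = −η(Λ⁻¹e₀, e₃)`. [cite: ONeill1983, Ch. 9, p. 233] -/
theorem coerSym_lorentz_apply_three_zero (Λ : lorentzGroup) :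
    ((Λ : E4 ≃L[ℝ] E4) (E4.basisVector 3)) 0 = -((Λ : E4 ≃L[ℝ] E4).symm (E4.basisVector 0)) 3 := by
  have h1 := minkowski_bilin_basisVector_zero_left ((Λ : E4 ≃L[ℝ] E4) (E4.basisVector 3))
  have h2 := Λ.2 ((Λ : E4 ≃L[ℝ] E4).symm (E4.basisVector 0)) (E4.basisVector 3)
  rw [ContinuousLinearEquiv.apply_symm_apply] at h2
  have h3 := minkowski_basisVector_succ ((Λ : E4 ≃L[ℝ] E4).symm (E4.basisVector 0)) 2
  rw [show (2 : Fin 3).succ = (3 : Fin 4) from rfl] at h3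
  linarith

/-- `((Λe₃)⁰)² ≤ ((Λe₀)⁰)² − 1`: `((Λ⁻¹e₀)³)² ≤ ‖(Λ⁻¹e₀)⃗‖² = ((Λe₀)⁰)² − 1`. [cite: ONeill1983, Ch. 9, p. 233] -/
theorem coerSym_lorentz_apply_three_zero_sq_le (Λ : lorentzGroup) :
    ((Λ : E4 ≃L[ℝ] E4) (E4.basisVector 3)) 0 ^ 2 ≤ ((Λ : E4 ≃L[ℝ] E4) (E4.basisVector 0)) 0 ^ 2 - 1 := by
  set z : E4 := (Λ : E4 ≃L[ℝ] E4).symm (E4.basisVector 0) with hz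
  have h1 : ((Λ : E4 ≃L[ℝ] E4) (E4.basisVector 3)) 0 = -z 3 := coerSym_lorentz_apply_three_zero Λ
  have h2 := lorentz_apply_zero_sq Λ⁻¹
  rw [coe_lorentz_inv, ← hz, lorentz_symm_apply_basisVector_zero, E4.spatialNorm_sq] at h2
  rw [h1]
  nlinarith [sq_nonneg (z 1), sq_nonneg (z 2)]

/-- **The forced rest-time slope is subluminal**: `|(Λe₃)⁰ / (Λe₀)⁰| < 1`. [cite: ONeill1983, Ch. 9, p. 233] -/
theorem coerSym_abs_v3_lt_one (Λ : lorentzGroup) :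
    |((Λ : E4 ≃L[ℝ] E4) (E4.basisVector 3)) 0 / ((Λ : E4 ≃L[ℝ] E4) (E4.basisVector 0)) 0| < 1 := by
  have h0 : ((Λ : E4 ≃L[ℝ] E4) (E4.basisVector 0)) 0 ≠ 0 := fun h ↦ by
    have h1 := one_le_abs_lorentz_apply_zero Λ
    rw [h, abs_zero] at h1
    linarith
  have h1 := coerSym_lorentz_apply_three_zero_sq_le Λ
  rw [abs_div, div_lt_one (abs_pos.2 h0)]
  exact sq_lt_sq.1 (by linarith)

end Slope

/-! ### Rest axis points with forced rest time land on the lab slab, inside the shell -/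

section Event

/-- `‖P‖` of an axis point `P = (t, 0, 0, ζ)` lies between `|ζ|` and `|t| + |ζ|`. [folklore] -/
theorem coerSym_norm_axis_point {P : E4} (h1 : P 1 = 0) (h2 : P 2 = 0) :
    |P 3| ≤ ‖P‖ ∧ ‖P‖ ≤ |P 0| + |P 3| := by
  refine ⟨by simpa using PiLp.norm_apply_le P 3, ?_⟩
  have h : ‖P‖ ^ 2 = P 0 ^ 2 + P 3 ^ 2 := by
    rw [EuclideanSpace.real_norm_sq_eq, Fin.sum_univ_four, h1, h2]; ring
  have h' : ‖P‖ ^ 2 ≤ (|P 0| + |P 3|) ^ 2 := by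
    rw [h]; nlinarith [abs_nonneg (P 0), abs_nonneg (P 3), sq_abs (P 0), sq_abs (P 3)]
  exact (pow_le_pow_iff_left₀ (norm_nonneg _) (by positivity) two_ne_zero).1 h'

/-- **A rest axis point with forced rest time is a lab event on the slab, inside the shell.** For
`Λ ∈ O(1,3)` with `|(Λe₀)⁰| ≤ γ` and `P = (−v₃ζ, 0, 0, ζ)`, `v₃ = (Λe₃)⁰/(Λe₀)⁰`: `(ΛP)⁰ = 0`,
`ΛP = (0, (ΛP)⃗)`, and `|ζ| ≤ (1 + 3γ)‖(ΛP)⃗‖`, `‖(ΛP)⃗‖ ≤ 2(1 + 3γ)|ζ|` (`norm_lorentz_le`,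
`norm_lorentz_symm_le'`, `|v₃| < 1`). [folklore] -/
theorem coerSym_axis_event (Λ : lorentzGroup) {γ : ℝ} (hγ : |((Λ : E4 ≃L[ℝ] E4) (E4.basisVector 0)) 0| ≤ γ)
    {P : E4} (h1 : P 1 = 0) (h2 : P 2 = 0)
    (h0 : P 0 = -(((Λ : E4 ≃L[ℝ] E4) (E4.basisVector 3)) 0 / ((Λ : E4 ≃L[ℝ] E4) (E4.basisVector 0)) 0 * P 3)) :
    ((Λ : E4 ≃L[ℝ] E4) P) 0 = 0 ∧
    (Λ : E4 ≃L[ℝ] E4) P = E4.ofTimeSpace 0 (E4.spatial ((Λ : E4 ≃L[ℝ] E4) P)) ∧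
    |P 3| ≤ (1 + 3 * γ) * ‖E4.spatial ((Λ : E4 ≃L[ℝ] E4) P)‖ ∧
    ‖E4.spatial ((Λ : E4 ≃L[ℝ] E4) P)‖ ≤ 2 * (1 + 3 * γ) * |P 3| := by
  set L : E4 ≃L[ℝ] E4 := (Λ : E4 ≃L[ℝ] E4) with hL
  set v₃ : ℝ := (L (E4.basisVector 3)) 0 / (L (E4.basisVector 0)) 0 with hv₃
  have hne : (L (E4.basisVector 0)) 0 ≠ 0 := fun h ↦ by
    have h1 := one_le_abs_lorentz_apply_zero Λ
    rw [← hL, h, abs_zero] at h1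
    linarith
  have hv : |v₃| < 1 := coerSym_abs_v3_lt_one Λ
  -- `P = P⁰ e₀ + P³ e₃`
  have hP : P = P 0 • E4.basisVector 0 + P 3 • E4.basisVector 3 := by
    ext i; fin_cases i <;> simp [E4.basisVector, h1, h2]
  have hLP0 : (L P) 0 = 0 := by
    rw [hP, map_add, map_smul, map_smul, PiLp.add_apply, PiLp.smul_apply, PiLp.smul_apply, smul_eq_mul,
      smul_eq_mul, h0, hv₃]
    field_simp
    ring
  have hLP : L P = E4.ofTimeSpace 0 (E4.spatial (L P)) := by
    conv_lhs => rw [← E4.ofTimeSpace_time_spatial (L P), E4.time_apply, hLP0]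
  have hnorm : ‖L P‖ = ‖E4.spatial (L P)‖ := by
    rw [norm_eq_spatialNorm_of_apply_zero_eq_zero hLP0, E4.spatialNorm]
  obtain ⟨hPlo, hPhi⟩ := coerSym_norm_axis_point h1 h2
  have hγ0 : 0 ≤ γ := (abs_nonneg _).trans hγ
  have hΛ : ‖(L : E4 →L[ℝ] E4)‖ ≤ 1 + 3 * γ := (norm_lorentz_le Λ).trans (by linarith)
  have hΛi : ‖(L.symm : E4 →L[ℝ] E4)‖ ≤ 1 + 3 * γ := (norm_lorentz_symm_le' Λ).trans (by linarith)
  refine ⟨hLP0, hLP, ?_, ?_⟩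
  · -- `|ζ| ≤ ‖P‖ = ‖Λ⁻¹(ΛP)‖ ≤ ‖Λ⁻¹‖ ‖ΛP‖`
    have h3 : ‖P‖ ≤ ‖(L.symm : E4 →L[ℝ] E4)‖ * ‖L P‖ := by
      have h := (L.symm : E4 →L[ℝ] E4).le_opNorm (L P)
      rwa [ContinuousLinearEquiv.coe_coe, ContinuousLinearEquiv.symm_apply_apply] at h
    rw [← hnorm]
    calc |P 3| ≤ ‖P‖ := hPlo
      _ ≤ ‖(L.symm : E4 →L[ℝ] E4)‖ * ‖L P‖ := h3
      _ ≤ (1 + 3 * γ) * ‖L P‖ := mul_le_mul_of_nonneg_right hΛi (norm_nonneg _)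
  · -- `‖ΛP‖ ≤ ‖Λ‖ ‖P‖ ≤ (1 + 3γ)(|v₃ζ| + |ζ|)`
    have h3 : ‖L P‖ ≤ ‖(L : E4 →L[ℝ] E4)‖ * ‖P‖ := (L : E4 →L[ℝ] E4).le_opNorm P
    have h4 : |P 0| ≤ |P 3| := by
      rw [h0, abs_neg, abs_mul]
      nlinarith [abs_nonneg (P 3), abs_nonneg v₃]
    rw [← hnorm]
    calc ‖L P‖ ≤ ‖(L : E4 →L[ℝ] E4)‖ * ‖P‖ := h3
      _ ≤ (1 + 3 * γ) * (|P 0| + |P 3|) :=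
          mul_le_mul hΛ hPhi (norm_nonneg _) (by linarith)
      _ ≤ 2 * (1 + 3 * γ) * |P 3| := by nlinarith

end Event

/-! ### Operators in the compact set of bounded Lorentz operators are painted frames -/

section Frames

/-- **An `η`-isometric operator with bounded Lorentz factor is `Λ⁻¹` for a painted frame `Λ`** with
the same bound (`injective_of_minkowski_isometry`, `lorentz_symm_apply_basisVector_zero`).
[cite: ONeill1983, Ch. 9, p. 233] -/
theorem coerSym_lorentz_of_mem_lorentzBounded {γ : ℝ} {S : E4 →L[ℝ] E4}
    (hS : S ∈ {L : E4 →L[ℝ] E4 | (∀ v w, Minkowski.bilin (L v) (L w) = Minkowski.bilin v w) ∧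
      |L (E4.basisVector 0) 0| ≤ γ}) :
    ∃ Λ : lorentzGroup, ((Λ : E4 ≃L[ℝ] E4).symm : E4 →L[ℝ] E4) = S ∧
      |((Λ : E4 ≃L[ℝ] E4) (E4.basisVector 0)) 0| ≤ γ := by
  obtain ⟨hS1, hS2⟩ := hS
  let Λ₀ : lorentzGroup := ⟨LinearEquiv.toContinuousLinearEquiv
      (LinearEquiv.ofInjectiveEndo (S : E4 →ₗ[ℝ] E4) (injective_of_minkowski_isometry hS1)),
    fun v w ↦ hS1 v w⟩
  have hcoe : (((Λ₀ : lorentzGroup) : E4 ≃L[ℝ] E4) : E4 →L[ℝ] E4) = S := by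
    ext v; rfl
  have hcoe0 : ((Λ₀ : lorentzGroup) : E4 ≃L[ℝ] E4) (E4.basisVector 0) 0 = S (E4.basisVector 0) 0 := rfl
  refine ⟨Λ₀⁻¹, ?_, ?_⟩
  · rw [coe_lorentz_inv, ContinuousLinearEquiv.symm_symm, hcoe]
  · rw [coe_lorentz_inv, lorentz_symm_apply_basisVector_zero, hcoe0]; exact hS2

/-- `Λ⁻¹` (as an operator) lies in the compact set of `η`-isometries with Lorentz factor `≤ γ`.
[cite: ONeill1983, Ch. 9, p. 233] -/
theorem coerSym_symm_mem_lorentzBounded {γ : ℝ} (Λ : lorentzGroup)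
    (hγ : |((Λ : E4 ≃L[ℝ] E4) (E4.basisVector 0)) 0| ≤ γ) :
    (((Λ : E4 ≃L[ℝ] E4).symm : E4 →L[ℝ] E4)) ∈ {L : E4 →L[ℝ] E4 |
      (∀ v w, Minkowski.bilin (L v) (L w) = Minkowski.bilin v w) ∧ |L (E4.basisVector 0) 0| ≤ γ} := by
  refine ⟨fun v w ↦ (Λ⁻¹).2 v w, ?_⟩
  rw [ContinuousLinearEquiv.coe_coe, lorentz_symm_apply_basisVector_zero]; exact hγ

/-- `poincareInv Λ 0 = Λ⁻¹` as maps. [folklore] -/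
theorem coerSym_poincareInv_zero (Λ : lorentzGroup) (x : E4) :
    poincareInv Λ 0 x = (((Λ : E4 ≃L[ℝ] E4).symm : E4 →L[ℝ] E4)) x := by
  simp [poincareInv]

/-- **Far on the lab slab ⇒ far in every painted frame**: for `‖y‖ ≥ |a| + L`, `L ≥ 0`, the painted
radius of the lab event `(0, y)` is `≥ L` for every `Λ ∈ O(1,3)` (`le_radius_poincareInv_of_le`).
[folklore] -/
theorem coerSym_le_radius_symm (Λ : lorentzGroup) (a : ℝ) {L : ℝ} (hL : 0 ≤ L) {y : E3}
    (hy : |a| + L ≤ ‖y‖) :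
    L ≤ Kerr.radius a ((((Λ : E4 ≃L[ℝ] E4).symm : E4 →L[ℝ] E4)) (E4.ofTimeSpace 0 y)) ∧
    L ≤ Kerr.radius a (poincareInv Λ 0 (E4.ofTimeSpace 0 y)) := by
  have h0 : E4.ofTimeSpace 0 (0 : E3) = (0 : E4) := by
    ext i; refine Fin.cases ?_ (fun j ↦ ?_) i <;> simp
  have h := le_radius_poincareInv_of_le Λ a 0 0 (x := E4.ofTimeSpace 0 y) (E4.ofTimeSpace_apply_zero 0 y) hL
    (by rwa [E4.spatial_ofTimeSpace, sub_zero])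
  rw [h0] at h
  exact ⟨by rwa [coerSym_poincareInv_zero] at h, h⟩

end Frames

/-- **Registered one-line carrier form** (`coerSym_v3_cs`, sub-goal of the crux item) of `coerSym_abs_v3_lt_one`: the forced rest-time slope of the lab axis events is subluminal. [cite: ONeill1983, Ch. 9, p. 233] -/
theorem coerSym_v3_cs : open Literature.Geometry.Lorentzian in ∀ (Λ : lorentzGroup), |((Λ : E4 ≃L[ℝ] E4) (E4.basisVector 3)) 0 / ((Λ : E4 ≃L[ℝ] E4) (E4.basisVector 0)) 0| < 1 :=
  coerSym_abs_v3_lt_one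

end Summit.FinalStateConjecture.FinalStateConjecture.Theorems.SublinearIsFree.Slaving

end
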